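import Summits.Langlands.Langlands.Theses.RootDecomp1
import Summits.Langlands.Langlands.Theses.CyclicLayerPeeling

/-! BC3 birth skeleton for `PrimeCyclicLayerDescent` (node `CyclicLayerPeeling`, lens-4 g23; THE ATOM).  PRE-BIRTH form: the crux is restated here by its filed text (def `PrimeCyclicLayerDescent` below =
route item verbatim); after birth swap it for the route decl `Summit.Langlands.Langlands.Theses.CyclicLayerPeeling.PrimeCyclicLayerDescent` (same text) and publish as `Cruxes/PrimeCyclicLayerDescent/Lines/birth.lean`.
Stubs carry `sorry` (registered); the composition `primeCyclicLayerDescent_of` is a REAL proof.  The cut follows Clifford theory for the normal subgroup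
Γ_M ◁ Γ_K of prime index p: `stub_splitHalf` (BC5 rung, PLAN-ONLY: a semisimple ρ over K exists that is Satake–Frobenius compatible with π at almost every
place of K that SPLITS COMPLETELY in M — replace r by a Gal(M/K)-invariant avatar of P (Brauer–Nesbitt: every r^σ is an avatar of P ≅ P^σ), extend σ-stable
constituents (H²(ℤ/p, ℚ̄_ℓ^×) = 0), induce the σ-moved ones; at split v, Frob_v = Frob_w ∈ Γ_M and the Satake data of π_v and P_w agree (f_v = 1 in AC (1.1)); technique:
Clifford 1937 + Chebotarev density; size M–L; this lies OUTSIDE S's known regime — it produces a compatible-on-density-1/p semisimple ρ for EVERY dark K) and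
`stub_inertUpgrade` (the hard stub = the atom proper: upgrade «compatible at split places» to «compatible almost everywhere» by TWIST SELECTION among the p^(#constituents)
Clifford twists, using only the p-th-power shadow (t_π,v)^p = t_P,w at inert v; n = 1 CFT, families Sorensen patching, single layer open). -/

set_option linter.dupNamespace false
set_option linter.unusedVariables false

open scoped BigOperators Topology Manifold Classical MeasureTheory ProbabilityTheory Matrix InnerProductSpace ComplexConjugate ContinuousMap
open Filter Set Function TopologicalSpace MeasureTheory

namespace Summit.Langlands.Langlands.Cruxes.PrimeCyclicLayerDescent.Birth

-- POST-BIRTH form: the local restated `def PrimeCyclicLayerDescent` of the pre-birth kit is removed; stubs unchanged; ONE closed theorem `PrimeCyclicLayerDescent_proof` concludes the ROUTE DECL by name.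

/-- stub C1 · SPLIT-PLACE HALF (BC5 rung, plan-only): a semisimple ρ over K compatible with π at almost all places split completely in M. -/
theorem stub_splitHalf :
    ∀ (K : Type) [Field K] [NumberField K] (n : ℕ) (hcpt : Literature.NumberTheory.Automorphic.isCompact_glFiniteIntegralLevel n K), 0 < n → ∀ (π : Literature.NumberTheory.Automorphic.CuspidalAutomorphicRepData n K hcpt), π.1.IsLAlgebraic → ∀ (M : Type) [Field M] [NumberField M] [Algebra K M], IsGalois K M → IsCyclic (M ≃ₐ[K] M) → (Module.finrank K M).Prime → ∀ (hM : Literature.NumberTheory.Automorphic.isCompact_glFiniteIntegralLevel n M) (P : Literature.NumberTheory.Automorphic.CuspidalAutomorphicRepData n M hM), P.1.IsLAlgebraic → Literature.NumberTheory.Automorphic.IsWeakBaseChangeLiftAE π.1 P.1 → ∀ (ℓ : ℕ) [Fact ℓ.Prime] (ι : PadicAlgCl ℓ ≃+* ℂ) (r : Literature.NumberTheory.GaloisRepresentations.FramedGaloisRep M (PadicAlgCl ℓ) n), r.toGaloisRep.IsSemisimple → (∀ᶠ w : IsDedekindDomain.HeightOneSpectrum (NumberField.RingOfIntegers M) in cofinite,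 SatakeFrobCompatibleAt ι P.1 r w) → ∃ ρ : Literature.NumberTheory.GaloisRepresentations.FramedGaloisRep K (PadicAlgCl ℓ) n, ρ.toGaloisRep.IsSemisimple ∧ ∀ᶠ v : IsDedekindDomain.HeightOneSpectrum (NumberField.RingOfIntegers K) in cofinite, (∀ w : IsDedekindDomain.HeightOneSpectrum (NumberField.RingOfIntegers M), w.asIdeal.under (NumberField.RingOfIntegers K) = v.asIdeal → w.asIdeal.inertiaDeg (NumberField.RingOfIntegers K) = 1) → SatakeFrobCompatibleAt ι π.1 ρ v := by
  sorry

/-- stub C2 · INERT UPGRADE = TWIST SELECTION (hardest stub): from «compatible at a.e. split place» to «compatible a.e.». -/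
theorem stub_inertUpgrade :
    ∀ (K : Type) [Field K] [NumberField K] (n : ℕ) (hcpt : Literature.NumberTheory.Automorphic.isCompact_glFiniteIntegralLevel n K), 0 < n → ∀ (π : Literature.NumberTheory.Automorphic.CuspidalAutomorphicRepData n K hcpt), π.1.IsLAlgebraic → ∀ (M : Type) [Field M] [NumberField M] [Algebra K M], IsGalois K M → IsCyclic (M ≃ₐ[K] M) → (Module.finrank K M).Prime → ∀ (hM : Literature.NumberTheory.Automorphic.isCompact_glFiniteIntegralLevel n M) (P : Literature.NumberTheory.Automorphic.CuspidalAutomorphicRepData n M hM), P.1.IsLAlgebraic → Literature.NumberTheory.Automorphic.IsWeakBaseChangeLiftAE π.1 P.1 → ∀ (ℓ : ℕ) [Fact ℓ.Prime] (ι : PadicAlgCl ℓ ≃+* ℂ) (r : Literature.NumberTheory.GaloisRepresentations.FramedGaloisRep M (PadicAlgCl ℓ) n), r.toGaloisRep.IsSemisimple → (∀ᶠ w : IsDedekindDomain.HeightOneSpectrum (NumberField.RingOfIntegers M) in cofinite, SatakeFrobCompatibleAt ι P.1 r w) → (∃ ρ : Literature.NumberTheory.GaloisRepresentations.FramedGaloisRep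 K (PadicAlgCl ℓ) n, ρ.toGaloisRep.IsSemisimple ∧ ∀ᶠ v : IsDedekindDomain.HeightOneSpectrum (NumberField.RingOfIntegers K) in cofinite, (∀ w : IsDedekindDomain.HeightOneSpectrum (NumberField.RingOfIntegers M), w.asIdeal.under (NumberField.RingOfIntegers K) = v.asIdeal → w.asIdeal.inertiaDeg (NumberField.RingOfIntegers K) = 1) → SatakeFrobCompatibleAt ι π.1 ρ v) → ∃ ρ : Literature.NumberTheory.GaloisRepresentations.FramedGaloisRep K (PadicAlgCl ℓ) n, ρ.toGaloisRep.IsSemisimple ∧ ∀ᶠ v : IsDedekindDomain.HeightOneSpectrum (NumberField.RingOfIntegers K) in cofinite, SatakeFrobCompatibleAt ι π.1 ρ v := by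
  sorry

/-- CLOSED COMPOSITION (post-birth shape, writer-1 WORD (A)(61)): the route decl `Summit.Langlands.Langlands.Theses.CyclicLayerPeeling.PrimeCyclicLayerDescent` from the registered stubs. -/
theorem PrimeCyclicLayerDescent_proof :
    Summit.Langlands.Langlands.Theses.CyclicLayerPeeling.PrimeCyclicLayerDescent := by
  have h1 := stub_splitHalf
  have h2 := stub_inertUpgrade
  intro K _ _ n hcpt hn π hπ M _ _ _ hG hC hp hM P hP hBC ℓ _ ι r hr hrc
  exact h2 K n hcpt hn π hπ M hG hC hp hM P hP hBC ℓ ι r hr hrc (h1 K n hcpt hn π hπ M hG hC hp hM P hP hBC ℓ ι r hr hrc)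

end Summit.Langlands.Langlands.Cruxes.PrimeCyclicLayerDescent.Birth
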